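import Mathlib
import Summits.Ventures.HodgeRepro.Tier4.Common.CompactOpenLevel
import Summits.Ventures.HodgeRepro.Tier4.Common.LevelBasis
import Summits.Ventures.HodgeRepro.Tier4.Line1.IsolatingTestsLevel

/-!
# Tier4/Line1/IsolatingTestsLevelK — F2′ AT A GENUINE LEVEL: the isolating test function of J2 bi-invariant under a
principal congruence subgroup `K(N) = levelK W N` (compact open in the finite adelic group), and the non-zero
`K(N)`-fixed vector in the invariant subspace it hits

Blind re-derivation cell `pub-hodge-repro`, Tier 4 (README §9–§10), seat t4-L1-p3 (gen 2).  Target tree path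
`lean/Summits/Ventures/HodgeRepro/Tier4/Line1/IsolatingTestsLevelK.lean`.  Imports this seat's
`IsolatingTestsLevel` (`exists_isolating_tests_level`: `∃ V ∈ 𝓝 1, ∀ K compact ⊆ V, …`; `exists_right_invariant_of_hit`)
and typer-2's `Common.CompactOpenLevel` (`levelK W N`, `isCompact_levelK`, `isCompactOpenIn_levelK`,
`levelK_le_finitePart`) + `Common.LevelBasis` (`exists_levelK_subset_nhds_one` — the principal congruence subgroups are
a neighbourhood basis of `1`; the WANTED-COMMON of S13483 (c) / S13521 (2), closed by typer-2 at S13697 / S13721).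

WHAT THIS IS.  The tower statement of F2′ (IsolatingTestsLevel) asked its consumer for a compact subgroup inside the
neighbourhood `V`; typer-2's `levelK W N` supplies one for every `V`.  So: for the defined tori and characters
(continuous, unitary, N2) there are a level `N ≠ 0` and an isolating pair `(f₁, f₂, o₀)` with `f₁` bi-invariant under
`K(N)` (`exists_isolating_tests_levelK`), and the invariant subspace `τ m` hit by `f̄₁` then contains a non-zero
`K(N)`-fixed vector (`exists_levelK_fixed_of_hit`): «`τ m` has level `N`».  What stays open for the free pin `lift`
(F1 + F2): the ARCHIMEDEAN refinement (an `f₁` whose archimedean component is `K_∞`-finite — Peter–Weyl density, not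
in Mathlib; t4-L1-p1 g3 S13625) and the identification itself.  Nothing here says anything about the status of the
Hodge conjecture for CM abelian varieties, which is NOT proved (HC_CM is NOT proved by anyone in this repository).
-/

set_option autoImplicit false

noncomputable section

namespace Summit.Ventures.HodgeRepro.Tier4.Line1

open NumberField Common MeasureTheory Topology

section LevelK

variable {k : Type} [Field k] [NumberField k] (W : PlaneData k) [MeasurableSpace (GA W)] [BorelSpace (GA W)]
  (hW : IsDefinite W) (hg : IsGenuineRow W) (R : RTFData W) (μ : Measure (GA W)) [μ.IsHaarMeasure]
  [R.μT.IsHaarMeasure] [R.μT'.IsHaarMeasure] (hT : IsCompact (closure R.DT)) (hT' : IsCompact (closure R.DT'))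

/-- **F2′ at a principal congruence level**: for the defined tori and characters there are `N ≠ 0` and an isolating
pair `(f₁, f₂, o₀)` — `f₁ ⋆ f₂` meets exactly `o₀` on `DT × DT′` with a non-zero orbital term — with `f₁`
bi-invariant under `K(N) = levelK W N` (compact open in the finite adelic group, `levelK_le_finitePart`). -/
theorem exists_isolating_tests_levelK (hc : Continuous R.chi) (hu : ∀ a, ‖R.chi a‖ = 1)
    (hc' : Continuous R.chi') (hu' : ∀ a, ‖R.chi' a‖ = 1) :
    ∃ N : ℕ, N ≠ 0 ∧
      ∃ (f₁ f₂ : GA W → ℂ) (o₀ : (Setting.ofAdelic W hW hg R μ hT hT').Orbit),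
        RTF.IsTest f₁ ∧ RTF.IsTest f₂ ∧ RTF.IsTest ((Setting.ofAdelic W hW hg R μ hT hT').conv f₁ f₂) ∧
        (Setting.ofAdelic W hW hg R μ hT hT').geoSupport ((Setting.ofAdelic W hW hg R μ hT hT').conv f₁ f₂) = {o₀} ∧
        (Setting.ofAdelic W hW hg R μ hT hT').orbital R.chi R.chi' o₀
          ((Setting.ofAdelic W hW hg R μ hT hT').conv f₁ f₂) ≠ 0 ∧
        ∀ k ∈ levelK W N, ∀ x, f₁ (x * k) = f₁ x ∧ f₁ (k * x) = f₁ x := by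
  obtain ⟨V, hVn, hV⟩ := exists_isolating_tests_level W hW hg R μ hT hT' hc hu hc' hu'
  obtain ⟨N, hN, hNV⟩ := exists_levelK_subset_nhds_one W hVn
  exact ⟨N, hN, hV (levelK W N) (isCompact_levelK W hN) hNV⟩

/-- **The level of the hit subspace**: with `f₁` bi-`K(N)`-invariant, an invariant subspace hit by `f̄₁` contains a
non-zero right-`K(N)`-invariant vector (`exists_right_invariant_of_hit` with `cj f₁`, which is left-`K(N)`-invariant
with `f₁`). -/
theorem exists_levelK_fixed_of_hit {N : ℕ} {f₁ : GA W → ℂ} (h₁ : RTF.IsTest f₁)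
    (hinv : ∀ k ∈ levelK W N, ∀ x, f₁ (x * k) = f₁ x ∧ f₁ (k * x) = f₁ x) {V : Set (GA W → ℂ)}
    (hV : (Setting.ofAdelic W hW hg R μ hT hT').IsInvariantSubspace V)
    (hhit : (Setting.ofAdelic W hW hg R μ hT hT').Hit (RTF.cj f₁) V) :
    ∃ ψ ∈ V, (∃ x, ψ x ≠ 0) ∧ ∀ k ∈ levelK W N, ∀ x, ψ (x * k) = ψ x :=
  (Setting.ofAdelic W hW hg R μ hT hT').exists_right_invariant_of_hit hV h₁.cj
    (fun k hk x => by simp only [RTF.cj, (hinv k hk x).2]) hhit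

end LevelK

end Summit.Ventures.HodgeRepro.Tier4.Line1

end
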